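import Summits.BirchSwinnertonDyer.BirchSwinnertonDyer.Theorems.EisensteinDepletionAtTwoStarOptBSFTypeAResidue
import HarnessLib

/-!
# Line `star` on crux E1M (stmt-BirchSwinnertonDyer-20341): the NODE LAW for Shimura points — the square-discriminant residue (SQΣ_f)
# reduced BY NAME to the Diophantine normal form «complementary discriminant = ±2⁸»

Lead star-p1 GEN 17.  v9.1's research stub `stub_sigmaSquare` (SQΣ_f: a FORMAL rational 2-torsion abscissa `r` of the `X₀(N)`-lattice-optimal
`W₀` whose Kummer parity is trivial on `Γ₁(N)` — a Shimura-type point `P` — forces `Δ(W₀) = ±c²`) is DERIVED here from the sharper, LOCAL statement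

  (N256) «for such `r`, with `α = b₂ + 12r`, `β = b₄ + r·b₂ + 6r²`: `α² − 32β = 256` or `α² − 32β = −256`»,

i.e. the discriminant `B² − 16C = α² − 32β` of the complementary quadratic `4x² + Bx + C` of the 2-division cubic (whose roots are the two OTHER 2-torsion
abscissae) is `±2⁸` on the minimal model.  Since `4Δ = β²(α² − 32β)` (tree, `four_mul_Δ_eq_of_isTwoTorsionNF_smul`), (N256) gives `Δ = ±(8β)²` in one line,
hence (SQΣ_f), hence (T1) (`TypeAResidue.optimalNotTypeA_of_sigmaSquareFormal`).  In the `+256` case the two other abscissae are RATIONAL and differ by `4`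
(`{r, e, e + 4}`: the Frey/habitat shape of the GEN 16 census); in the `−256` case they are `e ± 2i` (`ℚ(W₀[2]) = ℚ(i)`, the Neumann–Setzer shape) and `r` is odd.

MEANING (the node law).  For `p` odd, `v_p(α² − 32β) = 0` says the two non-`P` roots stay distinct mod `p`, i.e. at every multiplicative prime `P` reduces
to the NODE (the non-identity component), equivalently `Δ_min(W₀) = ±Δ_min(W₀/P)²`, equivalently (dually) the Shimura kernel `T = ker(W₁ → W₀)` of the
`X₁(N)`-type curve is TORIC (`−1 ∈ 𝔾_m` in the Tate model) at every `p ∣ N`; the 2-adic normalisation (`r = m/4`, `v₂(β) = −3`, `Δ` odd) then pins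
`|α² − 32β| = 2⁸`.  Conceptual source: `T` is generated by images of rational cuspidal divisors of `X₁(N)`, so `T ⊂ W₁⁰(ℚ_p)` whenever the Néron model of
`J₁(N)` has connected fibre at `p` — at PRIME level this is Conrad–Edixhoven–Stein 2003, Thm. 1.1.1 («J₁(p) has connected fibers»); at composite squarefree
level it is not in print (loc. cit. p. 328: «not worked out … for N > 1»).  DATA (this GEN, Cremona, exact arithmetic): over ALL 432 182 isogeny classes of odd
conductor `N < 5·10⁵` exactly 125 optimal curves carry a formal rational 2-torsion abscissa (all at squarefree `N`) and `α² − 32β = ±256` in all 125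
(`+256`: the 35 composite classes; `−256`: the 90 prime levels `17`, `u² + 64`); (M) `v_p(Δ(E₀)) = 2·v_p(Δ(E₀/P))` at every `p ∣ N`, 125/125.

* `Δ_eq_sq_or_neg_sq_of_complDisc` — (N256) at one curve ⇒ `Δ = ±(8β)²` (elementary);
* `exists_two_more_abscissae_of_complDisc_eq` — `α² − 32β = 256` ⇒ two further rational abscissae `e`, `e + 4` (elementary);
* `Δ_neg_of_complDisc_eq_neg`, `twoTorsionOdd_of_complDisc_eq_neg` — `α² − 32β = −256` ⇒ `Δ < 0`, the point is odd (elementary);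
* `sigmaSquare_of_sigmaNode` — (SQΣ_f) verbatim (the registered stub of v9.1) ⇐ (N256);
* `optimalNotTypeA_of_sigmaNode` — (T1) verbatim ⇐ UBD + Edixhoven + (N256).

CONDITIONAL on the prints (UBD, Edixhoven) and on (N256) where stated; no `sorry`, no new definition; nothing here reads `r_an`; E1M / BSD NOT proved.
-/

set_option linter.dupNamespace false
set_option autoImplicit false

noncomputable section

open scoped Classical MatrixGroups
open CongruenceSubgroup
open WeierstrassCurve Literature.NumberTheory.EllipticCurves Literature.NumberTheory.EllipticCurves.Greenberg1999
open Literature.NumberTheory.EllipticCurves.ModularForms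

namespace Summit.BirchSwinnertonDyer.BirchSwinnertonDyer.Theorems.DepletionAtTwo.SigmaNode

/-! ### Elementary: the complementary discriminant `α² − 32β` and `4Δ = β²(α² − 32β)` -/

/-- **`4Δ = β²(α² − 32β)` at a rational 2-torsion abscissa `r`** (`α = b₂ + 12r`, `β = b₄ + r b₂ + 6r²`): the tree identity
`four_mul_Δ_eq_of_isTwoTorsionNF_smul` for the change of variables `⟨1, r, −a₁/2, y⟩` to 2-torsion normal form. [cite: SilvermanAEC2009, III.1 (b-invariants) and III.2.3] -/
theorem four_mul_Δ_eq (W : WeierstrassCurve ℚ) [W.IsElliptic] {r : ℚ} (hr : HasRationalTwoTorsionX W r) :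
    4 * W.Δ = (W.b₄ + r * W.b₂ + 6 * r ^ 2) ^ 2 * ((W.b₂ + 12 * r) ^ 2 - 32 * (W.b₄ + r * W.b₂ + 6 * r ^ 2)) := by
  obtain ⟨y, hEq, h2⟩ := hr
  set C : VariableChange ℚ := ⟨1, r, -W.a₁ / 2, y⟩ with hC
  have hns : W.toAffine.Nonsingular r y := (WeierstrassCurve.Affine.equation_iff_nonsingular).mp hEq
  have hy : y = W.toAffine.negY r y := by
    rw [WeierstrassCurve.Affine.negY]; linear_combination h2
  haveI : (C • W).IsTwoTorsionNF := isTwoTorsionNF_smul_of_two_nsmul_eq_zero two_ne_zero hns hy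
  have h4Δ := four_mul_Δ_eq_of_isTwoTorsionNF_smul W C
  have hCr : C.r = r := rfl
  rw [hCr] at h4Δ
  linear_combination h4Δ

/-- **(N256) at one curve ⇒ `Δ = ±(8β)²`.**  If the complementary discriminant `α² − 32β` of a rational 2-torsion abscissa `r` is `±256`, then
`Δ = (8β)²` or `Δ = −(8β)²`. [cite: SilvermanAEC2009, III.1 (b-invariants) and III.2.3] -/
theorem Δ_eq_sq_or_neg_sq_of_complDisc (W : WeierstrassCurve ℚ) [W.IsElliptic] {r : ℚ} (hr : HasRationalTwoTorsionX W r)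
    (h : (W.b₂ + 12 * r) ^ 2 - 32 * (W.b₄ + r * W.b₂ + 6 * r ^ 2) = 256 ∨
      (W.b₂ + 12 * r) ^ 2 - 32 * (W.b₄ + r * W.b₂ + 6 * r ^ 2) = -256) :
    ∃ c : ℚ, W.Δ = c ^ 2 ∨ W.Δ = -c ^ 2 := by
  have h4 := four_mul_Δ_eq W hr
  refine ⟨8 * (W.b₄ + r * W.b₂ + 6 * r ^ 2), ?_⟩
  rcases h with h | h
  · left; rw [h] at h4; linear_combination h4 / 4
  · right; rw [h] at h4; linear_combination h4 / 4

/-- **`α² − 32β = −256` ⇒ `Δ < 0`.** (`4Δ = −256β²` and `β ≠ 0` since `Δ ≠ 0`.) [cite: SilvermanAEC2009, III.1 (b-invariants) and III.2.3] -/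
theorem Δ_neg_of_complDisc_eq_neg (W : WeierstrassCurve ℚ) [W.IsElliptic] {r : ℚ} (hr : HasRationalTwoTorsionX W r)
    (h : (W.b₂ + 12 * r) ^ 2 - 32 * (W.b₄ + r * W.b₂ + 6 * r ^ 2) = -256) : W.Δ < 0 := by
  have h4 := four_mul_Δ_eq W hr
  rw [h] at h4
  have hΔ0 : W.Δ ≠ 0 := by rw [← W.coe_Δ']; exact W.Δ'.ne_zero
  have hβ0 : W.b₄ + r * W.b₂ + 6 * r ^ 2 ≠ 0 := by
    intro h0; apply hΔ0; rw [h0] at h4; linarith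
  have hpos : 0 < (W.b₄ + r * W.b₂ + 6 * r ^ 2) ^ 2 := by positivity
  nlinarith

/-- **`α² − 32β = −256` ⇒ the point is odd** (`Δ < 0`: the unique real 2-torsion abscissa is the least one, `twoTorsionOdd_of_Δ_neg`).
[cite: GreenbergLNM1716, §5 Remark (p. 121)] -/
theorem twoTorsionOdd_of_complDisc_eq_neg (W : WeierstrassCurve ℚ) [W.IsElliptic] {r : ℚ} (hr : HasRationalTwoTorsionX W r)
    (h : (W.b₂ + 12 * r) ^ 2 - 32 * (W.b₄ + r * W.b₂ + 6 * r ^ 2) = -256) : TwoTorsionOdd W r :=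
  twoTorsionOdd_of_Δ_neg W (Δ_neg_of_complDisc_eq_neg W hr h) hr

/-- **`α² − 32β = 256` ⇒ two further rational 2-torsion abscissae `e` and `e + 4`, both `≠ r`** — the `{r, e, e + 4}` shape of the optimal centres in
the GEN 16 census.  With `B = b₂ + 4r`, `C = 2b₄ + rb₂ + 4r²` the 2-division cubic is `(x − r)(4x² + Bx + C)` and `B² − 16C = α² − 32β = 16²`, so the
complementary roots are `(−B ± 16)/8 = −B/8 ∓ 2`. [cite: SilvermanAEC2009, III.1 and III.2.3 (ψ₂)] -/
theorem exists_two_more_abscissae_of_complDisc_eq (W : WeierstrassCurve ℚ) [W.IsElliptic] {r : ℚ} (hr : HasRationalTwoTorsionX W r)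
    (h : (W.b₂ + 12 * r) ^ 2 - 32 * (W.b₄ + r * W.b₂ + 6 * r ^ 2) = 256) :
    ∃ e : ℚ, e ≠ r ∧ e + 4 ≠ r ∧ HasRationalTwoTorsionX W e ∧ HasRationalTwoTorsionX W (e + 4) := by
  obtain ⟨y, hEq, h2⟩ := hr
  have hcubic := fourXCubed_add_eq_zero_of_twoTorsion hEq h2
  set B : ℚ := W.b₂ + 4 * r with hB
  set Cq : ℚ := 2 * W.b₄ + r * W.b₂ + 4 * r ^ 2 with hCq
  have hdisc : B ^ 2 - 16 * Cq = 256 := by rw [hB, hCq, ← h]; ring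
  have key : ∀ x : ℚ, 4 * x ^ 3 + W.b₂ * x ^ 2 + 2 * W.b₄ * x + W.b₆ =
      (x - r) * (((8 * x + B) ^ 2 - (B ^ 2 - 16 * Cq)) / 16) + (4 * r ^ 3 + W.b₂ * r ^ 2 + 2 * W.b₄ * r + W.b₆) := by
    intro x; rw [hB, hCq]; ring
  have hroot : ∀ ε : ℚ, ε ^ 2 = 1 → 4 * ((-B + ε * 16) / 8) ^ 3 + W.b₂ * ((-B + ε * 16) / 8) ^ 2 +
      2 * W.b₄ * ((-B + ε * 16) / 8) + W.b₆ = 0 := by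
    intro ε hε
    rw [key, hcubic, hdisc]
    have h8 : 8 * ((-B + ε * 16) / 8) + B = ε * 16 := by ring
    rw [h8, mul_pow, hε]
    ring
  have hminus := hroot (-1) (by norm_num)
  have hplus := hroot 1 (by norm_num)
  -- the cubic has the three roots `r`, `e = (−B − 16)/8`, `e + 4 = (−B + 16)/8`; `r` is a simple root since `β ≠ 0`
  have hΔ0 : W.Δ ≠ 0 := by rw [← W.coe_Δ']; exact W.Δ'.ne_zero
  have h4 := four_mul_Δ_eq W ⟨y, hEq, h2⟩
  rw [h] at h4
  have hβ0 : W.b₄ + r * W.b₂ + 6 * r ^ 2 ≠ 0 := by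
    intro h0; apply hΔ0; rw [h0] at h4; linarith
  -- value of the complementary quadratic at `r` is `2β`
  have hquad : ∀ x : ℚ, ((8 * x + B) ^ 2 - (B ^ 2 - 16 * Cq)) / 16 = 4 * x ^ 2 + B * x + Cq := by intro x; ring
  have hCr : 4 * r ^ 2 + B * r + Cq = 2 * (W.b₄ + r * W.b₂ + 6 * r ^ 2) := by rw [hB, hCq]; ring
  have hne : ∀ ε : ℚ, ε ^ 2 = 1 → (-B + ε * 16) / 8 ≠ r := by
    intro ε hε hεr
    have hz : 4 * ((-B + ε * 16) / 8) ^ 2 + B * ((-B + ε * 16) / 8) + Cq = 0 := by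
      rw [← hquad]
      have h8 : 8 * ((-B + ε * 16) / 8) + B = ε * 16 := by ring
      rw [h8, mul_pow, hε, hdisc]; ring
    rw [hεr, hCr] at hz
    exact hβ0 (by linarith)
  refine ⟨(-B + (-1) * 16) / 8, hne (-1) (by norm_num), ?_, SfPositions.hasRationalTwoTorsionX_of_cubic W hminus, ?_⟩
  · have : (-B + (-1) * 16) / 8 + 4 = (-B + 1 * 16) / 8 := by ring
    rw [this]; exact hne 1 (by norm_num)
  · have : (-B + (-1) * 16) / 8 + 4 = (-B + 1 * 16) / 8 := by ring
    rw [this]; exact SfPositions.hasRationalTwoTorsionX_of_cubic W hplus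

/-! ### (SQΣ_f) and (T1) from the node law (N256) -/

/-- **(SQΣ_f) — the registered research stub `stub_sigmaSquare` of Lines/star.lean v9.1, VERBATIM — from the node law (N256)** (same binders, conclusion
`α² − 32β = ±256`; stated inline).  One line: `Δ = ±(8β)²` (`Δ_eq_sq_or_neg_sq_of_complDisc`); the lattice / parity hypotheses are only threaded through.
CONDITIONAL on (N256). [cite: ConradEdixhovenStein2003, Thm. 1.1.1] [cite: SilvermanAEC2009, III.1 and III.2.3] -/
theorem sigmaSquare_of_sigmaNode
    (hN : ∀ (W₀ : WeierstrassCurve ℚ) [W₀.IsElliptic] [W₀.IsGloballyMinimal]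
      ⦃N : ℕ⦄ [NeZero N] (f : CuspForm (Gamma0 N) 2), IsNewformOf W₀ f → IsOrdinaryAt W₀ 2 →
      ∀ (L₀ : PeriodPair), IsNeronLatticeOf (W₀.baseChange ℂ) L₀ → ∀ (q : ℚ), q ≠ 0 →
      (∀ z ∈ periodLattice f, (q : ℂ) * z ∈ L₀.lattice) → (∀ z ∈ L₀.lattice, ∃ w ∈ periodLattice f, z = (q : ℂ) * w) →
      ∀ (x : ℚ), HasRationalTwoTorsionX W₀ x → TwoTorsionRamifiedAtTwo x →
      ∀ (lam : ℂ), lam ∈ L₀.lattice → lam / 2 ∉ L₀.lattice →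
        L₀.weierstrassP (lam / 2) - ((W₀.b₂ : ℚ) : ℂ) / 12 = ((x : ℚ) : ℂ) →
      (∀ (γ : SL(2, ℤ)) (hγ : γ ∈ Gamma0 N), γ ∈ Gamma1 N →
        ∃ k : ℤ, ∃ w ∈ L₀.lattice, (q : ℂ) * cuspSymbol f ⟨γ, hγ⟩ = (k : ℂ) * lam + 2 * w) →
      (W₀.b₂ + 12 * x) ^ 2 - 32 * (W₀.b₄ + x * W₀.b₂ + 6 * x ^ 2) = 256 ∨
        (W₀.b₂ + 12 * x) ^ 2 - 32 * (W₀.b₄ + x * W₀.b₂ + 6 * x ^ 2) = -256) :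
    ∀ (W₀ : WeierstrassCurve ℚ) [W₀.IsElliptic] [W₀.IsGloballyMinimal]
      ⦃N : ℕ⦄ [NeZero N] (f : CuspForm (Gamma0 N) 2), IsNewformOf W₀ f → IsOrdinaryAt W₀ 2 →
      ∀ (L₀ : PeriodPair), IsNeronLatticeOf (W₀.baseChange ℂ) L₀ → ∀ (q : ℚ), q ≠ 0 →
      (∀ z ∈ periodLattice f, (q : ℂ) * z ∈ L₀.lattice) → (∀ z ∈ L₀.lattice, ∃ w ∈ periodLattice f, z = (q : ℂ) * w) →
      ∀ (x : ℚ), HasRationalTwoTorsionX W₀ x → TwoTorsionRamifiedAtTwo x →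
      ∀ (lam : ℂ), lam ∈ L₀.lattice → lam / 2 ∉ L₀.lattice →
        L₀.weierstrassP (lam / 2) - ((W₀.b₂ : ℚ) : ℂ) / 12 = ((x : ℚ) : ℂ) →
      (∀ (γ : SL(2, ℤ)) (hγ : γ ∈ Gamma0 N), γ ∈ Gamma1 N →
        ∃ k : ℤ, ∃ w ∈ L₀.lattice, (q : ℂ) * cuspSymbol f ⟨γ, hγ⟩ = (k : ℂ) * lam + 2 * w) →
      ∃ c : ℚ, W₀.Δ = c ^ 2 ∨ W₀.Δ = -c ^ 2 := by
  intro W₀ _ _ N _ f hW₀ hord L₀ hL₀ q hq hin hout x hx hram lam hlam hlam2 hwp hpar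
  exact Δ_eq_sq_or_neg_sq_of_complDisc W₀ hx (hN W₀ f hW₀ hord L₀ hL₀ q hq hin hout x hx hram lam hlam hlam2 hwp hpar)

/-- **(T1) «the lattice-optimal curve is never of type A» from THEOREM A at 2 and the node law (N256)**: `TypeAResidue.optimalNotTypeA_of_sigmaSquareFormal`
composed with `sigmaSquare_of_sigmaNode`.  Conclusion: the statement of v8's stub `stub_optimalNotTypeA` verbatim.  CONDITIONAL on UBD, Edixhoven, (N256).
[cite: CalegariDimitrovTang2025, Thm. 1.0.1] [cite: Edixhoven1991, Prop. 2] [cite: ConradEdixhovenStein2003, Thm. 1.1.1] -/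
theorem optimalNotTypeA_of_sigmaNode
    (hU : Literature.NumberTheory.Automorphic.CalegariDimitrovTang2025_unboundedDenominators)
    (hEd : edixhoven_optimalManinConstant_integral)
    (hN : ∀ (W₀ : WeierstrassCurve ℚ) [W₀.IsElliptic] [W₀.IsGloballyMinimal]
      ⦃N : ℕ⦄ [NeZero N] (f : CuspForm (Gamma0 N) 2), IsNewformOf W₀ f → IsOrdinaryAt W₀ 2 →
      ∀ (L₀ : PeriodPair), IsNeronLatticeOf (W₀.baseChange ℂ) L₀ → ∀ (q : ℚ), q ≠ 0 →
      (∀ z ∈ periodLattice f, (q : ℂ) * z ∈ L₀.lattice) → (∀ z ∈ L₀.lattice, ∃ w ∈ periodLattice f, z = (q : ℂ) * w) →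
      ∀ (x : ℚ), HasRationalTwoTorsionX W₀ x → TwoTorsionRamifiedAtTwo x →
      ∀ (lam : ℂ), lam ∈ L₀.lattice → lam / 2 ∉ L₀.lattice →
        L₀.weierstrassP (lam / 2) - ((W₀.b₂ : ℚ) : ℂ) / 12 = ((x : ℚ) : ℂ) →
      (∀ (γ : SL(2, ℤ)) (hγ : γ ∈ Gamma0 N), γ ∈ Gamma1 N →
        ∃ k : ℤ, ∃ w ∈ L₀.lattice, (q : ℂ) * cuspSymbol f ⟨γ, hγ⟩ = (k : ℂ) * lam + 2 * w) →
      (W₀.b₂ + 12 * x) ^ 2 - 32 * (W₀.b₄ + x * W₀.b₂ + 6 * x ^ 2) = 256 ∨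
        (W₀.b₂ + 12 * x) ^ 2 - 32 * (W₀.b₄ + x * W₀.b₂ + 6 * x ^ 2) = -256) :
    ∀ (W₀ : WeierstrassCurve ℚ) [W₀.IsElliptic] [W₀.IsGloballyMinimal]
      ⦃N : ℕ⦄ [NeZero N] (f : CuspForm (Gamma0 N) 2), IsNewformOf W₀ f → IsOrdinaryAt W₀ 2 →
      ∀ (L₀ : PeriodPair), IsNeronLatticeOf (W₀.baseChange ℂ) L₀ → ∀ (q : ℚ), q ≠ 0 →
      (∀ z ∈ periodLattice f, (q : ℂ) * z ∈ L₀.lattice) → (∀ z ∈ L₀.lattice, ∃ w ∈ periodLattice f, z = (q : ℂ) * w) →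
      ∀ (x₀ : ℚ), HasUniqueRationalTwoTorsionX W₀ x₀ → TwoTorsionRamifiedAtTwo x₀ → TwoTorsionOdd W₀ x₀ :=
  TypeAResidue.optimalNotTypeA_of_sigmaSquareFormal hU hEd (sigmaSquare_of_sigmaNode hN)

end Summit.BirchSwinnertonDyer.BirchSwinnertonDyer.Theorems.DepletionAtTwo.SigmaNode

end
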